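import Summits.Ventures.PercRepro.ProfileTwoCosimple

/-!
# PercRepro — THE ROW `q = 2` ON SIMPLE MATROIDS REDUCES TO ONE DELETION STEP
(p10, gen 3; S5 §2.5 of `proofs/SUBCLAIM-S5-p10.md`)

`INDEP_{2,u}(M)` (the independent half of the row `q = 2` of the profile inequality — on every simple matroid
it IS the row, by the bridge `profileIneq_two_of_indep`) is the inequality
`Σ_{B independent pair} demand(B) ≤ C(u,2) · #{independent u-sets}`, `demand(B) = [u ≤ ρ(E∖B)] · C(ρ(E∖B), u−2)`.

This file proves that `INDEP_{2,u}` holds on EVERY simple matroid as soon as the following single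
DELETION STEP holds on every simple matroid with at least `u + 3` elements (for some `z`, and we assume it for all):

  `STEP′(z)`: `Σ_B demand_M(B) ≤ Σ_B demand_{M∖z}(B) + C(u,2) · #{independent u-sets of M containing z}`

— equivalently, the slack `C(u,2)·I_u − Σ demand` of `INDEP_{2,u}` does not decrease when `z` is added to the
ground set.  The proof is a strong induction on the number of elements: the independent `u`-sets split by
`z ∉ S` / `z ∈ S` (`card_indepSets_eq_delete_add_through`), the matroids with `≤ u + 1` elements have no demand
(`demand_eq_zero_of_card_le`), and on `u + 2` elements the inequality holds on the nose — the pairs `B` with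
`E ∖ B` independent correspond to the independent `u`-sets (`indep2_of_card_eq`).  The statement is verified
exactly on every simple matroid on `≤ 9` elements, for EVERY `z` and every `3 ≤ u ≤ min(ρ(E), |E| − 3)`
(5,106,537 instances at `|E| = 9`, 0 failures; `mining/p10/g3/`), and fails for `u = |E| − 2` (where it is not
needed).  Nothing here asserts that `STEP′` holds in general: `DelStep` is a hypothesis of the assembly theorem.

* `Indep2 M u` — `INDEP_{2,u}(M)`;
* `indepSetsThrough M u z` — the independent `u`-sets containing `z`;
* `DelStep M z u` — `STEP′(z)` at level `u`;
* `card_indepSets_eq_delete_add_through` — `I_u(M) = I_u(M ∖ z) + #{S ∈ I_u(M) : z ∈ S}`;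
* `indep2_of_card_le`, `indep2_of_card_eq`, `indep2_of_rk_lt` — the degenerate levels;
* **`indep2_of_delStep`** — `STEP′` on every simple matroid with `≥ u + 3` elements ⟹ `INDEP_{2,u}` on every
  simple matroid.
-/

open scoped Matroid

namespace PercRepro.Cogirth

open Finset ThmH Skew Shadow Profile

variable {α : Type} [DecidableEq α] {M : Matroid α} [M.Finite]

/-- `INDEP_{2,u}(M)`: `Σ_{B independent pair} demand(B) ≤ C(u,2) · #{independent u-sets}`. -/
def Indep2 (M : Matroid α) [M.Finite] (u : ℕ) : Prop :=
  ∑ B ∈ indepSets M 2, demand M 2 u B ≤ u.choose 2 * (indepSets M u).card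

/-- The independent `u`-sets of `M` containing `z`. -/
noncomputable def indepSetsThrough (M : Matroid α) [M.Finite] (u : ℕ) (z : α) : Finset (Finset α) :=
  (indepSets M u).filter (fun S => z ∈ S)

/-- **The deletion step `STEP′(z)`** at level `u`: the demand of `M` exceeds the demand of `M ∖ z` by at most
`C(u,2)` times the number of independent `u`-sets through `z`. -/
def DelStep (M : Matroid α) [M.Finite] (z : α) (u : ℕ) : Prop :=
  ∑ B ∈ indepSets M 2, demand M 2 u B ≤
    ∑ B ∈ indepSets (M ＼ ({z} : Set α)) 2, demand (M ＼ ({z} : Set α)) 2 u B +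
      u.choose 2 * (indepSetsThrough M u z).card

/-! ### The split of the independent `u`-sets at an element -/

/-- The independent `u`-sets of `M ∖ z` are the independent `u`-sets of `M` avoiding `z`. -/
theorem indepSets_delete_eq_filter (z : α) (u : ℕ) :
    indepSets (M ＼ ({z} : Set α)) u = (indepSets M u).filter (fun S => z ∉ S) := by
  ext S
  rw [mem_indepSets, mem_filter, mem_indepSets, gr_delete', Matroid.delete_indep_iff]
  constructor
  · rintro ⟨hS, hc, hI, hd⟩
    refine ⟨⟨hS.trans (erase_subset z _), hc, hI⟩, ?_⟩
    intro hz
    exact (mem_erase.1 (hS hz)).1 rfl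
  · rintro ⟨⟨hS, hc, hI⟩, hz⟩
    refine ⟨subset_erase.2 ⟨hS, hz⟩, hc, hI, ?_⟩
    rw [Set.disjoint_singleton_right, Finset.mem_coe]
    exact hz

/-- `I_u(M) = I_u(M ∖ z) + #{S ∈ I_u(M) : z ∈ S}`. -/
theorem card_indepSets_eq_delete_add_through (z : α) (u : ℕ) :
    (indepSets M u).card =
      (indepSets (M ＼ ({z} : Set α)) u).card + (indepSetsThrough M u z).card := by
  rw [indepSets_delete_eq_filter, indepSetsThrough, add_comm]
  exact (card_filter_add_card_filter_not (s := indepSets M u) (fun S => z ∈ S)).symm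

/-! ### The degenerate levels -/

/-- Above the rank, the demand vanishes. -/
theorem demand_eq_zero_of_rk_lt {u : ℕ} {B : Finset α} (h : rk M (gr M \ B) < u) :
    demand M 2 u B = 0 := by
  unfold demand
  rw [if_neg (not_le.2 h)]

/-- `INDEP_{2,u}` above the rank of `M`. -/
theorem indep2_of_rk_lt {u : ℕ} (h : rk M (gr M) < u) : Indep2 M u := by
  unfold Indep2
  rw [Finset.sum_eq_zero]
  · exact Nat.zero_le _
  intro B _
  exact demand_eq_zero_of_rk_lt (lt_of_le_of_lt (rk_mono' sdiff_subset) h)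

/-- The complement of an independent pair has `|E| − 2` elements. -/
theorem card_sdiff_of_mem_indepSets_two {B : Finset α} (hB : B ∈ indepSets M 2) :
    (gr M \ B).card = (gr M).card - 2 := by
  rw [mem_indepSets] at hB
  rw [card_sdiff, inter_eq_left.2 hB.1, hB.2.1]

/-- On at most `u + 1` elements there is no demand at level `u`. -/
theorem demand_eq_zero_of_card_le {u : ℕ} (hn : (gr M).card ≤ u + 1) (hu : 1 ≤ u) {B : Finset α}
    (hB : B ∈ indepSets M 2) : demand M 2 u B = 0 := by
  apply demand_eq_zero_of_rk_lt
  have h1 := rk_le_card (M := M) (gr M \ B)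
  rw [card_sdiff_of_mem_indepSets_two hB] at h1
  omega

/-- `INDEP_{2,u}` on at most `u + 1` elements. -/
theorem indep2_of_card_le {u : ℕ} (hn : (gr M).card ≤ u + 1) (hu : 1 ≤ u) : Indep2 M u := by
  unfold Indep2
  rw [Finset.sum_eq_zero (fun B hB => demand_eq_zero_of_card_le hn hu hB)]
  exact Nat.zero_le _

omit [DecidableEq α] in
/-- A finset whose rank is its cardinality is independent. -/
theorem indep_of_rk_eq_card {X : Finset α} (h : rk M X = X.card) : M.Indep (X : Set α) := by
  rw [Matroid.indep_iff_eRk_eq_encard_of_finite (Finset.finite_toSet X), ← coe_rk, h,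
    Set.encard_coe_eq_coe_finsetCard]

open Classical in
/-- On exactly `u + 2` elements the demand of a pair `B` is `C(u,2)` if `E ∖ B` is independent and `0`
otherwise. -/
theorem demand_of_card_eq {u : ℕ} (hn : (gr M).card = u + 2) (hu : 2 ≤ u) {B : Finset α}
    (hB : B ∈ indepSets M 2) :
    demand M 2 u B = if M.Indep ((gr M \ B : Finset α) : Set α) then u.choose 2 else 0 := by
  have hc : (gr M \ B).card = u := by
    rw [card_sdiff_of_mem_indepSets_two hB, hn]
    omega
  have hle : rk M (gr M \ B) ≤ u := hc ▸ rk_le_card (M := M) (gr M \ B)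
  by_cases hI : M.Indep ((gr M \ B : Finset α) : Set α)
  · rw [if_pos hI]
    unfold demand
    rw [rk_eq_card_of_indep hI, hc, if_pos le_rfl, Nat.choose_symm hu]
  · rw [if_neg hI]
    apply demand_eq_zero_of_rk_lt
    rcases Nat.lt_or_ge (rk M (gr M \ B)) u with hlt | hge
    · exact hlt
    · exact absurd (indep_of_rk_eq_card (by rw [hc]; omega)) hI

open Classical in
/-- On exactly `u + 2` elements `INDEP_{2,u}` holds: the pairs `B` with `E ∖ B` independent inject into the
independent `u`-sets by `B ↦ E ∖ B`. -/
theorem indep2_of_card_eq {u : ℕ} (hn : (gr M).card = u + 2) (hu : 2 ≤ u) : Indep2 M u := by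
  unfold Indep2
  rw [Finset.sum_congr rfl (fun B hB => demand_of_card_eq hn hu hB), ← Finset.sum_filter,
    Finset.sum_const, smul_eq_mul, mul_comm]
  apply Nat.mul_le_mul_left
  apply card_le_card_of_injOn (fun B => gr M \ B)
  · intro B hB
    rw [Finset.mem_coe, mem_filter, mem_indepSets] at hB
    rw [Finset.mem_coe, mem_indepSets]
    refine ⟨sdiff_subset, ?_, hB.2⟩
    rw [card_sdiff, inter_eq_left.2 hB.1.1, hB.1.2.1, hn]
    omega
  · intro B hB B' hB' h
    rw [Finset.mem_coe, mem_filter, mem_indepSets] at hB hB'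
    have h1 : gr M \ (gr M \ B) = gr M \ (gr M \ B') := by
      simp only at h
      rw [h]
    rwa [Finset.sdiff_sdiff_eq_self hB.1.1, Finset.sdiff_sdiff_eq_self hB'.1.1] at h1

/-! ### Simplicity is preserved by deletion -/

/-- A single-element deletion of a simple matroid is simple. -/
theorem simple'_delete (hs : Simple' M) (z : α) : Simple' (M ＼ ({z} : Set α)) := by
  intro B hB hc
  rw [gr_delete'] at hB
  rw [Matroid.delete_indep_iff]
  refine ⟨hs B (hB.trans (erase_subset z _)) hc, ?_⟩
  rw [Set.disjoint_singleton_right, Finset.mem_coe]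
  intro hz
  exact (mem_erase.1 (hB hz)).1 rfl

/-! ### The assembly -/

/-- **`STEP′` implies the row.**  If the deletion step `DelStep N z u` holds for every simple matroid `N` on
`≥ u + 3` elements, every `z ∈ E(N)` and every `3 ≤ u ≤ ρ(E)`, then `INDEP_{2,u}` holds on every simple
matroid at every level `u ≥ 3`.  Strong induction on the number of elements. -/
theorem indep2_of_delStep
    (hstep : ∀ (N : Matroid α) [N.Finite], Simple' N → ∀ z ∈ gr N, ∀ u : ℕ, 3 ≤ u →
      u + 3 ≤ (gr N).card → u ≤ rk N (gr N) → DelStep N z u) :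
    ∀ (n : ℕ) (M : Matroid α) [M.Finite], (gr M).card = n → Simple' M →
      ∀ u : ℕ, 3 ≤ u → Indep2 M u := by
  intro n
  induction n using Nat.strong_induction_on with
  | _ n ih =>
    intro M _ hn hs u hu
    rcases Nat.lt_or_ge (rk M (gr M)) u with hlt | huR
    · exact indep2_of_rk_lt hlt
    rcases Nat.lt_or_ge n (u + 2) with hsmall | hbig
    · exact indep2_of_card_le (by omega) (by omega)
    rcases Nat.eq_or_lt_of_le hbig with heq | hgt
    · exact indep2_of_card_eq (by omega) (by omega)
    have hne : (gr M).Nonempty := by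
      rw [← card_pos]
      omega
    obtain ⟨z, hz⟩ := hne
    have hstepz := hstep M hs z hz u hu (by omega) huR
    have hcard : (gr (M ＼ ({z} : Set α))).card = n - 1 := by
      rw [gr_delete', card_erase_of_mem hz, hn]
    have hih := ih (n - 1) (by omega) (M ＼ ({z} : Set α)) hcard (simple'_delete hs z) u hu
    unfold Indep2 at hih ⊢
    unfold DelStep at hstepz
    rw [card_indepSets_eq_delete_add_through z u, mul_add]
    exact hstepz.trans (Nat.add_le_add_right hih _)

/-- The same, stated for one matroid. -/
theorem indep2_of_delStep' (hs : Simple' M)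
    (hstep : ∀ (N : Matroid α) [N.Finite], Simple' N → ∀ z ∈ gr N, ∀ u : ℕ, 3 ≤ u →
      u + 3 ≤ (gr N).card → u ≤ rk N (gr N) → DelStep N z u) {u : ℕ} (hu : 3 ≤ u) :
    Indep2 M u :=
  indep2_of_delStep hstep (gr M).card M rfl hs u hu

end PercRepro.Cogirth
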